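import Summits.CriticalPhenomena.PercolationContinuityZ3.Theorems.Transplant.KNParaChainSchedNP
import Summits.CriticalPhenomena.PercolationContinuityZ3.Theorems.Transplant.SkelPhiParaRunChain
import Summits.CriticalPhenomena.PercolationContinuityZ3.Theorems.Transplant.SkelPhiRunQSteps
import Summits.CriticalPhenomena.PercolationContinuityZ3.Theorems.Transplant.SkelPhiQStepsN
import Summits.CriticalPhenomena.PercolationContinuityZ3.Theorems.Transplant.SkelPhiHabLevels
import Summits.CriticalPhenomena.PercolationContinuityZ3.Theorems.Transplant.BoxProdZ2SeedGeom
import HarnessLib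

/-!
# N2 (frames-only node `SamePDropOfSkeletonFrm₁`, OPEN), (C) column: **THE DEPTH ROW OF THE CORRIDOR CHAIN FROM THE RUN FRAME'S QUASI-STEPS** —
# `Skelφ.coreWindow_nonempty_of_qsteps`: for ANY `S : ChainPlanar.ScheduleNP` read in `runX φ c₀ n h σ` over a habitat `Ω`, the window of every core
# `WinIn (runX …) Ω (S.core (k+1))` (`k ≤ N`) is NONEMPTY as soon as the plain windows over the prism lie in `Ω` (`hΩball`, the capstone's row) and the
# plain radius covers the quasi-step reach of the prism from the frame origin (`hR : D₀ + (kq+3)·(|z₀| + |z₁|) ≤ R` for `z ∈ prism`, `c₀ ∈ B(w₀, D₀)`):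
# every planar point is HIT EXACTLY by a vertex (p1's `QStepsN.exists_mem_graphBall_eq` at `qStepsN_runX`).  Discharges `hTne` of
# `reachChainF_of_kgCorr(Y)` (SkelPhiCorridorKGReach / KGYReach) down to one radius row — the twin of N1's `coreTF₂_nonempty` (SkelPhiNegReachTargets :140).
builds on p205010 (kernel theorem, internal audit signed; external expert review pending) — nothing in this file uses p205010; nothing here is a
claim about the open node `SamePDropOfSkeletonFrm₁`.
Lane `prim-bschramm`, seat `prim-bschramm-p5` (gen 15; (C) lineage); helper file (`--supports stmt-CriticalPhenomena-4575 --as helper`).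
[cite: KozmaNitzan2024, §4 Lemma 12 (pp. 23–25: nonempty targets)] [cite: MartineauTassion2017, §4.3 (quasi-steps of the frame)]
-/

noncomputable section

namespace Summit.CriticalPhenomena.PercolationContinuityZ3.Theorems.Transplant

namespace Skelφ

open Literature.Probability.Percolation Literature.Probability.LatticeModels SimpleGraph
open Literature.Barriers.CriticalPhenomena (graphBall graphBall_mono)
open ChainPlanar

variable {V : Type} {G : SimpleGraph V} {φ : V → Site 2}

/-- **THE CORE WINDOWS OF A SCHEDULE READ IN THE x-RUN FRAME ARE NONEMPTY** (depth row `hTne` of the corridor chain): from the frame's quasi-steps,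
the window-in-habitat row and one radius row. [cite: KozmaNitzan2024, §4 Lemma 12 (pp. 23–25)] -/
theorem coreWindow_nonempty_of_qsteps (hstep : Steps G φ) {n : ℕ} (hn : 1 ≤ n) (c₀ : V) (h : ℤ) {σ : ℤ} (hσ : σ = 1 ∨ σ = -1) {kq : ℕ}
    (hκ : h.natAbs ≤ kq * n) (S : ScheduleNP) {Ω : Finset V} {w₀ : V} {R D₀ : ℕ} (hc₀ : c₀ ∈ graphBall G w₀ D₀)
    (hΩball : ∀ u ∈ graphBall G w₀ R, runX φ c₀ n h σ u ∈ S.prism → u ∈ Ω)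
    (hR : ∀ z ∈ S.prism, D₀ + (kq + 3) * ((z 0).natAbs + (z 1).natAbs) ≤ R) :
    ∀ k ≤ S.N, (WinIn (runX φ c₀ n h σ) Ω (ScheduleNP.core S (k + 1))).Nonempty := by
  intro k hk
  obtain ⟨z, hz⟩ := S.nonempty (k + 1) (by omega)
  have hzP : z ∈ S.prism := S.sub_prism k hk (S.succ k hk hz)
  obtain ⟨g, hg, hgz⟩ := QStepsN.exists_mem_graphBall_eq (qStepsN_runX hstep hn c₀ h hσ hκ) c₀ z
  rw [runX_origin] at hg
  simp only [Pi.zero_apply, sub_zero] at hg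
  have hgw : g ∈ graphBall G w₀ (D₀ + (kq + 3) * ((z 0).natAbs + (z 1).natAbs)) := BoxProdZ2.mem_graphBall_add G hc₀ hg
  have hgR : g ∈ graphBall G w₀ R := graphBall_mono G _ (hR z hzP) hgw
  refine ⟨g, (mem_WinIn (φ := runX φ c₀ n h σ)).2 ⟨hΩball g hgR (by rw [hgz]; exact hzP), ?_⟩⟩
  rw [hgz]; exact hz

end Skelφ

end Summit.CriticalPhenomena.PercolationContinuityZ3.Theorems.Transplant

end
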